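import Mathlib
import Summits.Ventures.PercRepro2.Defs
import Summits.Ventures.PercRepro2.Graph
import Summits.Ventures.PercRepro2.Events
import Summits.Ventures.PercRepro2.Harris
import Summits.Ventures.PercRepro2.BHKAvoid
import Summits.Ventures.PercRepro2.OrderPreservation
import Summits.Ventures.PercRepro2.HCov

/-!
# (HCOV) with an inactive `a₃` IS the BHK cross-cluster inequality
(blind cell PercRepro2, mine-2 g15; MINE-2.md M2-24 §4)

Call `a₃` **inactive** when no configuration connects it to a root (for every `ω`,
`a₁ ↮ a₃` and `a₂ ↮ a₃`; e.g. `a₃` has no incident edge, `inactive_of_isolated`). Then the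
`a₃`-worlds `T = Q ∩ {a₃ ∈ C₂}`, `T′ = Q ∩ {a₃ ∈ C₁}` are empty and `PD = Q`, every
`σ₃`-mass of `Gc` vanishes, and the covariance form collapses EXACTLY onto the two
cross-cluster slacks of the `(b, o)` side table under `Q = {a₁ ↮ a₂}` (`Gc_eq_of_a3Inactive`):

  `Gc = 2 P(Q) · [ S(bL, oH) + S(bH, oL) ]`,
  `S(bL, oH) = P(Q, bL) P(Q, oH) − P(Q) P(Q, bL, oH)`,  `S(bH, oL) = P(Q, bH) P(Q, oL) − P(Q) P(Q, bH, oL)`,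

and each slack is `≥ 0` (`bLoH_mul_Q_le`, `bHoL_mul_Q_le`) by van den Berg–Häggström–Kahn's Theorem 1.4 (`bhk_cross_cluster_avoid`
with `s = a₁`, `t = a₂`, `X = {a₂}`, up-sets `{b ∈ ·}`, `{o ∈ ·}`, and its mirror): given
`a₁ ↮ a₂`, «`b` on `a₁`'s side» and «`o` on `a₂`'s side» are negatively correlated. Hence
`HCov_of_a3Inactive` — (HCOV) holds whenever `a₃` is inactive, in particular for an isolated
`a₃` (`HCov_of_isolated_a3`), with the explicit value above. So the conjecture (HCOV) is a
third-mark extension of BHK06 Thm 1.4: the `a₃`-active content of `Gc` — the `PD` conditioning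
and the `σ₃ (1_{o ∈ U²} − 1_{o ∈ U³})` term — is exactly what lies beyond BHK, and it is where
every (CW)/(RECM) violation lives (M2-24 §4: with `a₃` isolated the typed (CW) holds, 0 / 673,332).
(Own exact checks: the identity on 30 / 30 random weighted instances, gcx.py.)
-/

namespace Summit.Ventures.PercRepro2
namespace A3Inactive

open CovForm UnionCluster

variable {V : Type*} {E : Type*} [Fintype E] [DecidableEq E] [DecidableEq V]
  {R : Type*} [Field R] [LinearOrder R] [IsStrictOrderedRing R]

/-! ## The `a₃`-worlds of an inactive `a₃` -/

section Sets

variable {ends : E → Sym2 V} {a₁ a₂ a₃ : V}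

omit [Fintype E] [DecidableEq E] [DecidableEq V] in
/-- `T = ∅` for an inactive `a₃`. -/
lemma TEvent_eq_empty (h : ∀ ω : Config E, ¬ Conn ends ω a₁ a₃ ∧ ¬ Conn ends ω a₂ a₃) : TEvent ends a₁ a₂ a₃ = ∅ := by
  ext ω
  simp only [TEvent, Set.mem_inter_iff, Set.mem_compl_iff, mem_connEvent,
    Set.mem_empty_iff_false, iff_false, not_and]
  exact fun _ h23 => (h ω).2 h23

omit [Fintype E] [DecidableEq E] [DecidableEq V] in
/-- `T′ = ∅` for an inactive `a₃`. -/
lemma TEvent'_eq_empty (h : ∀ ω : Config E, ¬ Conn ends ω a₁ a₃ ∧ ¬ Conn ends ω a₂ a₃) : TEvent ends a₂ a₁ a₃ = ∅ := by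
  ext ω
  simp only [TEvent, Set.mem_inter_iff, Set.mem_compl_iff, mem_connEvent,
    Set.mem_empty_iff_false, iff_false, not_and]
  exact fun _ h13 => (h ω).1 h13

omit [Fintype E] [DecidableEq E] [DecidableEq V] in
/-- `PD = Q` for an inactive `a₃`. -/
lemma PDEvent_eq_Q (h : ∀ ω : Config E, ¬ Conn ends ω a₁ a₃ ∧ ¬ Conn ends ω a₂ a₃) :
    PDEvent ends a₁ a₂ a₃ = avoidAll ends a₂ {a₁} := by
  ext ω
  simp only [PDEvent, Dtilde, inU, Set.mem_inter_iff, Set.mem_compl_iff, Set.mem_union,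
    mem_connEvent, mem_avoidAll, Finset.mem_singleton, forall_eq]
  constructor
  · rintro ⟨h12, _⟩
    exact fun h21 => h12 (conn_symm h21)
  · intro h21
    refine ⟨fun h12 => h21 (conn_symm h12), ?_⟩
    rintro (h31 | h32)
    · exact (h ω).1 (conn_symm h31)
    · exact (h ω).2 (conn_symm h32)

omit [Fintype E] [DecidableEq E] [DecidableEq V] in
/-- `{a₁ ↮ a₂}` does not depend on which root avoids the other. -/
lemma avoidAll_singleton_comm (ends : E → Sym2 V) (a₁ a₂ : V) :
    avoidAll ends a₁ {a₂} = avoidAll ends a₂ {a₁} := by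
  ext ω
  simp only [mem_avoidAll, Finset.mem_singleton, forall_eq]
  exact ⟨fun h h' => h (conn_symm h'), fun h h' => h (conn_symm h')⟩

omit [Fintype E] [DecidableEq E] [DecidableEq V] in
/-- A vertex without incident edges is connected to nothing else. -/
lemma eq_of_conn_of_no_edge {ω : Config E} {u v : V} (hv : ∀ e, v ∉ ends e)
    (h : Conn ends ω u v) : u = v := by
  have key : u ∈ ({v} : Set V) := by
    refine mem_of_conn_of_closed (ends := ends) (ω := ω) ?_ (Set.mem_singleton v) (conn_symm h)
    intro x hx y hxy
    rw [Set.mem_singleton_iff] at hx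
    subst hx
    obtain ⟨_, e, _, hends⟩ := openGraph_adj.1 hxy
    exact absurd (show x ∈ ends e by rw [hends]; exact Sym2.mem_mk_left x y) (hv e)
  exact Set.mem_singleton_iff.1 key

omit [Fintype E] [DecidableEq E] [DecidableEq V] in
/-- An isolated `a₃` (no incident edge, distinct from the roots) is inactive. -/
lemma inactive_of_isolated (h3 : ∀ e, a₃ ∉ ends e) (h13 : a₁ ≠ a₃) (h23 : a₂ ≠ a₃) :
    ∀ ω : Config E, ¬ Conn ends ω a₁ a₃ ∧ ¬ Conn ends ω a₂ a₃ :=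
  fun _ => ⟨fun h => h13 (eq_of_conn_of_no_edge h3 h), fun h => h23 (eq_of_conn_of_no_edge h3 h)⟩

end Sets

/-! ## The identity -/

omit [DecidableEq V] in
/-- **`Gc` with an inactive `a₃` is twice `P(Q)` times the sum of the two cross-cluster
slacks**: `Gc = 2 P(Q) · (S(bL, oH) + S(bH, oL))`. -/
theorem Gc_eq_of_a3Inactive (p : E → R) (ends : E → Sym2 V) (o a₁ a₂ a₃ b : V)
    (h : ∀ ω : Config E, ¬ Conn ends ω a₁ a₃ ∧ ¬ Conn ends ω a₂ a₃) :
    Gc p ends o a₁ a₂ a₃ b =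
      2 * prob p (avoidAll ends a₂ {a₁}) *
        ((prob p (avoidAll ends a₂ {a₁} ∩ connEvent ends a₁ b) *
            prob p (avoidAll ends a₂ {a₁} ∩ connEvent ends a₂ o) -
          prob p (avoidAll ends a₂ {a₁}) *
            prob p (avoidAll ends a₂ {a₁} ∩ (connEvent ends a₂ o ∩ connEvent ends a₁ b))) +
         (prob p (avoidAll ends a₂ {a₁} ∩ connEvent ends a₂ b) *
            prob p (avoidAll ends a₂ {a₁} ∩ connEvent ends a₁ o) -
          prob p (avoidAll ends a₂ {a₁}) *
            prob p (avoidAll ends a₂ {a₁} ∩ (connEvent ends a₁ o ∩ connEvent ends a₂ b)))) := by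
  unfold Gc DEF EQbo EQb3 EQb3o EQo EQ3 EQ3o PDb PDbo Do
  rw [gap_eq_Q]
  simp only [TEvent_eq_empty h, TEvent'_eq_empty h, PDEvent_eq_Q h, Set.empty_inter, prob_empty]
  ring

/-! ## Signs (BHK06 Thm 1.4; the cross-cluster blocks need `Fintype V`) -/

section Signs

variable [Fintype V]

/-- `S(bL, oH) ≥ 0`: `bhk_cross_cluster_avoid` with `s = a₁`, `t = a₂`, `X = {a₂}`,
up-sets `{b ∈ ·}` for `C(a₁)` and `{o ∈ ·}` for `C(a₂)`. -/
theorem bLoH_mul_Q_le (p : E → R) (hp : IsProbVec p) (ends : E → Sym2 V) (o a₁ a₂ b : V) :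
    prob p (avoidAll ends a₂ {a₁}) *
        prob p (avoidAll ends a₂ {a₁} ∩ (connEvent ends a₂ o ∩ connEvent ends a₁ b)) ≤
      prob p (avoidAll ends a₂ {a₁} ∩ connEvent ends a₁ b) *
        prob p (avoidAll ends a₂ {a₁} ∩ connEvent ends a₂ o) := by
  have h := bhk_cross_cluster_avoid p hp ends a₁ a₂ (X := {a₂}) (Finset.mem_singleton_self a₂)
    (isUpperSet_mem_setOf b) (isUpperSet_mem_setOf o)
  rw [← connEvent_eq_clusterInEvent ends a₁ b, ← connEvent_eq_clusterInEvent ends a₂ o,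
    avoidAll_singleton_comm ends a₁ a₂] at h
  have e1 : connEvent ends a₁ b ∩ connEvent ends a₂ o ∩ avoidAll ends a₂ {a₁} =
      avoidAll ends a₂ {a₁} ∩ (connEvent ends a₂ o ∩ connEvent ends a₁ b) := by
    ext; simp only [Set.mem_inter_iff]; tauto
  have e2 : connEvent ends a₁ b ∩ avoidAll ends a₂ {a₁} =
      avoidAll ends a₂ {a₁} ∩ connEvent ends a₁ b := Set.inter_comm _ _
  have e3 : connEvent ends a₂ o ∩ avoidAll ends a₂ {a₁} =
      avoidAll ends a₂ {a₁} ∩ connEvent ends a₂ o := Set.inter_comm _ _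
  rw [e1, e2, e3] at h
  linarith [h]

/-- `S(bH, oL) ≥ 0`: the mirror instance (`s = a₂`, `t = a₁`, `X = {a₁}`). -/
theorem bHoL_mul_Q_le (p : E → R) (hp : IsProbVec p) (ends : E → Sym2 V) (o a₁ a₂ b : V) :
    prob p (avoidAll ends a₂ {a₁}) *
        prob p (avoidAll ends a₂ {a₁} ∩ (connEvent ends a₁ o ∩ connEvent ends a₂ b)) ≤
      prob p (avoidAll ends a₂ {a₁} ∩ connEvent ends a₂ b) *
        prob p (avoidAll ends a₂ {a₁} ∩ connEvent ends a₁ o) := by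
  have h := bhk_cross_cluster_avoid p hp ends a₂ a₁ (X := {a₁}) (Finset.mem_singleton_self a₁)
    (isUpperSet_mem_setOf b) (isUpperSet_mem_setOf o)
  rw [← connEvent_eq_clusterInEvent ends a₂ b, ← connEvent_eq_clusterInEvent ends a₁ o] at h
  have e1 : connEvent ends a₂ b ∩ connEvent ends a₁ o ∩ avoidAll ends a₂ {a₁} =
      avoidAll ends a₂ {a₁} ∩ (connEvent ends a₁ o ∩ connEvent ends a₂ b) := by
    ext; simp only [Set.mem_inter_iff]; tauto
  have e2 : connEvent ends a₂ b ∩ avoidAll ends a₂ {a₁} =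
      avoidAll ends a₂ {a₁} ∩ connEvent ends a₂ b := Set.inter_comm _ _
  have e3 : connEvent ends a₁ o ∩ avoidAll ends a₂ {a₁} =
      avoidAll ends a₂ {a₁} ∩ connEvent ends a₁ o := Set.inter_comm _ _
  rw [e1, e2, e3] at h
  linarith [h]

/-- **(HCOV) for an inactive `a₃`** — it is the BHK cross-cluster inequality (twice). -/
theorem HCov_of_a3Inactive (p : E → R) (hp : IsProbVec p) (ends : E → Sym2 V) (o a₁ a₂ a₃ b : V)
    (h : ∀ ω : Config E, ¬ Conn ends ω a₁ a₃ ∧ ¬ Conn ends ω a₂ a₃) : HCov p ends o a₁ a₂ a₃ b := by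
  unfold HCov
  rw [Gc_eq_of_a3Inactive p ends o a₁ a₂ a₃ b h]
  have hQ := prob_nonneg hp (avoidAll ends a₂ {a₁})
  have h1 := bLoH_mul_Q_le p hp ends o a₁ a₂ b
  have h2 := bHoL_mul_Q_le p hp ends o a₁ a₂ b
  have hS : 0 ≤ (prob p (avoidAll ends a₂ {a₁} ∩ connEvent ends a₁ b) *
            prob p (avoidAll ends a₂ {a₁} ∩ connEvent ends a₂ o) -
          prob p (avoidAll ends a₂ {a₁}) *
            prob p (avoidAll ends a₂ {a₁} ∩ (connEvent ends a₂ o ∩ connEvent ends a₁ b))) +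
         (prob p (avoidAll ends a₂ {a₁} ∩ connEvent ends a₂ b) *
            prob p (avoidAll ends a₂ {a₁} ∩ connEvent ends a₁ o) -
          prob p (avoidAll ends a₂ {a₁}) *
            prob p (avoidAll ends a₂ {a₁} ∩ (connEvent ends a₁ o ∩ connEvent ends a₂ b))) := by
    linarith
  exact mul_nonneg (mul_nonneg (by norm_num) hQ) hS

/-- **(HCOV) for an isolated `a₃`** (no incident edge; `a₃` distinct from the roots). -/
theorem HCov_of_isolated_a3 (p : E → R) (hp : IsProbVec p) (ends : E → Sym2 V) (o a₁ a₂ a₃ b : V)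
    (h3 : ∀ e, a₃ ∉ ends e) (h13 : a₁ ≠ a₃) (h23 : a₂ ≠ a₃) : HCov p ends o a₁ a₂ a₃ b :=
  HCov_of_a3Inactive p hp ends o a₁ a₂ a₃ b (inactive_of_isolated h3 h13 h23)

end Signs

end A3Inactive
end Summit.Ventures.PercRepro2
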